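import Summits.Ventures.Crystal3D.Theorems.StickyWulffConstantNoReconstructionGainBlanketSegment
import Summits.Ventures.Crystal3D.Theorems.StickyWulffConstantNoReconstructionGainCellFluxIsolated
import Summits.Ventures.Crystal3D.Theorems.StickyWulffConstantNoReconstructionGainCellFluxTwelve
import Summits.Ventures.Crystal3D.Theorems.StickyWulffConstantNoReconstructionGainConeBand
import HarnessLib

/-!
# The BLANKET BOUND in the coplanar case (`BlanketBoundCoplanar`, planner cf-p1 g14's rung)

HONEST FRAMING. Part of the venture `Summits/Ventures/Crystal3D` (cell `crystal3d-full`), helper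
`--supports` the crux `NoReconstructionGain` (stmt-Ventures-19144, route
`route-Ventures-StickyWulffConstant`), BLANKET line of planner cf-p1 (gen 14, `lines/blanket/Blanket.lean`;
definitions landed verbatim in `Theorems/…CellFluxDefs.lean`).  We prove the rung `BlanketBoundCoplanar` BY
NAME (its `shadowArea`, `blanketRadius` read in the landed `CellFlux` namespace, same text):

  for every finite unit packing `x` whose centres all lie in one plane `⊥ ν` (`‖ν‖ = 1`),
  `2√3 · S_ν(x; 1/√3) ≤ 6 N − C(x)`.

Proof (the planner's "pointwise Voronoi"): the shadow slab is covered by the LATERAL VORONOI CELLS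
`Vᵢ = {y in i's disc slab : lateralSq (x i) y ≤ lateralSq (x j) y ∀ j}`; for a coplanar contact neighbour
`j` the cell `Vᵢ` misses the circular segment `Hᵢⱼ = {⟪y − xᵢ, xⱼ − xᵢ⟫ > 1/2}` of `i`'s disc, the segments
of distinct contact neighbours are disjoint (two unit vectors `≥ 60°` apart cannot both have inner product
`> 1/2` with a vector of length `≤ 1/√3`), each has area `π/18 − 1/(4√3)` (`volume_segmentSlab`), the disc
has area `π/3` (`volume_lateralSlab`), so `|Vᵢ| ≤ π/3 − degᵢ (π/18 − 1/(4√3))`; coplanar coordination is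
`≤ 6` (`card_thin_band_le_six` after the isometry `ν ↦ e₃`); and
`2√3 (π/3 − d (π/18 − 1/(4√3))) = 6 − d/2 − (6 − d)(1 − √3 π/9) ≤ 6 − d/2` for `d ≤ 6`, with equality iff
`d = 6` (the hexagonal cell).  Summation and the handshake `Σ degᵢ = 2 C(x)` finish.

WHAT THIS IS NOT: the blanket bound for non-coplanar packings (conjecture; its dissolution form D is
refuted, cf-p2 R27); nothing about the crux at `ν ≠ ±e₃`; rung F-C1 not moved.
-/

noncomputable section

namespace Summit.Ventures.Crystal3D.Theorems

open Summit.Ventures.Crystal3D Finset MeasureTheory Set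
open Summit.Ventures.Crystal3D.Cruxes.NoReconstructionGain.CellFlux
open scoped InnerProductSpace

/-! ### Continuity / measurability of the lateral distance -/

/-- `y ↦ lateralSq ν c y` is continuous. -/
theorem continuous_lateralSq (ν c : EuclideanSpace ℝ (Fin 3)) : Continuous fun y => lateralSq ν c y := by
  unfold lateralSq
  fun_prop

/-- `y ↦ lateralSq ν c y` is measurable. -/
theorem measurable_lateralSq (ν c : EuclideanSpace ℝ (Fin 3)) : Measurable fun y => lateralSq ν c y :=
  (continuous_lateralSq ν c).measurable

/-- `y ↦ |⟪y, ν⟫|` is measurable. -/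
theorem measurable_abs_inner (ν : EuclideanSpace ℝ (Fin 3)) :
    Measurable fun y : EuclideanSpace ℝ (Fin 3) => |⟪y, ν⟫_ℝ| := by
  have : Continuous fun y : EuclideanSpace ℝ (Fin 3) => |⟪y, ν⟫_ℝ| := by fun_prop
  exact this.measurable

/-! ### The lateral Voronoi cells cover the shadow -/

/-- The shadow slab is covered by the lateral Voronoi cells of the discs. -/
theorem shadowSlab_subset_iUnion_voronoi (ν : EuclideanSpace ℝ (Fin 3)) (r : ℝ) {N : ℕ}
    (x : Fin N → EuclideanSpace ℝ (Fin 3)) :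
    shadowSlab ν r x ⊆ ⋃ i, {y : EuclideanSpace ℝ (Fin 3) | lateralSq ν (x i) y ≤ r ^ 2 ∧
      |⟪y, ν⟫_ℝ| ≤ 1 / 2 ∧ ∀ j, lateralSq ν (x i) y ≤ lateralSq ν (x j) y} := by
  rintro y ⟨⟨i₀, hi₀⟩, hy⟩
  obtain ⟨i, -, hi⟩ := exists_min_image univ (fun j => lateralSq ν (x j) y) ⟨i₀, mem_univ _⟩
  refine mem_iUnion.2 ⟨i, (hi i₀ (mem_univ _)).trans hi₀, hy, fun j => hi j (mem_univ _)⟩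

/-! ### Coplanar neighbours: the Voronoi cell misses the contact segments -/

/-- Difference of lateral distances to two centres at the same height. -/
theorem lateralSq_sub_lateralSq (ν a b y : EuclideanSpace ℝ (Fin 3)) (hab : ⟪a - b, ν⟫_ℝ = 0) :
    lateralSq ν b y - lateralSq ν a y = ‖b - a‖ ^ 2 - 2 * ⟪y - a, b - a⟫_ℝ := by
  unfold lateralSq
  have h1 : y - b = (y - a) - (b - a) := by abel
  have h2 : ⟪y - b, ν⟫_ℝ = ⟪y - a, ν⟫_ℝ := by
    rw [h1, inner_sub_left]
    have : ⟪b - a, ν⟫_ℝ = 0 := by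
      rw [show b - a = -(a - b) by abel, inner_neg_left, hab, neg_zero]
    rw [this, sub_zero]
  rw [h2, h1, norm_sub_sq_real]
  ring

/-- In the Voronoi cell of `i`, `⟪y − xᵢ, xⱼ − xᵢ⟫ ≤ 1/2` for every coplanar contact neighbour `j`. -/
theorem inner_le_half_of_voronoi (ν xi xj y : EuclideanSpace ℝ (Fin 3)) (hcop : ⟪xi - xj, ν⟫_ℝ = 0)
    (hd : dist xi xj = 1) (hV : lateralSq ν xi y ≤ lateralSq ν xj y) :
    ⟪y - xi, xj - xi⟫_ℝ ≤ 1 / 2 := by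
  have h := lateralSq_sub_lateralSq ν xi xj y hcop
  rw [dist_eq_norm, ← norm_neg, neg_sub] at hd
  rw [hd] at h
  linarith

/-- `‖lateral ν c y‖² = lateralSq ν c y`. -/
theorem norm_sq_lateral (ν c y : EuclideanSpace ℝ (Fin 3)) (hν : ‖ν‖ = 1) :
    ‖lateral ν c y‖ ^ 2 = lateralSq ν c y := by
  have := norm_sq_lateral_add_smul ν c y hν 0
  simpa using this

/-- `⟪lateral ν c y, u⟫ = ⟪y − c, u⟫` for `u ⊥ ν`. -/
theorem inner_lateral_of_orth (ν c y u : EuclideanSpace ℝ (Fin 3)) (hu : ⟪u, ν⟫_ℝ = 0) :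
    ⟪lateral ν c y, u⟫_ℝ = ⟪y - c, u⟫_ℝ := by
  unfold lateral
  rw [inner_sub_left, inner_smul_left, real_inner_comm u ν, hu]; simp

/-- **Two contact segments are disjoint.**  If `u, v` are unit vectors `⊥ ν` with `⟪u, v⟫ ≤ 1/2` and
`lateralSq ν c y ≤ 1/3`, then `⟪y − c, u⟫ > 1/2` and `⟪y − c, v⟫ > 1/2` cannot both hold. -/
theorem not_both_segments (ν c y u v : EuclideanSpace ℝ (Fin 3)) (hν : ‖ν‖ = 1) (hu : ‖u‖ = 1)
    (hv : ‖v‖ = 1) (huν : ⟪u, ν⟫_ℝ = 0) (hvν : ⟪v, ν⟫_ℝ = 0) (huv : ⟪u, v⟫_ℝ ≤ 1 / 2)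
    (hL : lateralSq ν c y ≤ 1 / 3) (h1 : 1 / 2 < ⟪y - c, u⟫_ℝ) (h2 : 1 / 2 < ⟪y - c, v⟫_ℝ) : False := by
  set w := lateral ν c y with hw
  have hwu : ⟪w, u⟫_ℝ = ⟪y - c, u⟫_ℝ := inner_lateral_of_orth ν c y u huν
  have hwv : ⟪w, v⟫_ℝ = ⟪y - c, v⟫_ℝ := inner_lateral_of_orth ν c y v hvν
  have hww : ‖w‖ ^ 2 ≤ 1 / 3 := by rw [hw, norm_sq_lateral ν c y hν]; exact hL
  have hsum : 1 < ⟪w, u + v⟫_ℝ := by rw [inner_add_right, hwu, hwv]; linarith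
  have hcs := abs_real_inner_le_norm w (u + v)
  have huv2 : ‖u + v‖ ^ 2 ≤ 3 := by
    rw [norm_add_sq_real, hu, hv]; linarith
  have hlt : 1 < ⟪w, u + v⟫_ℝ ^ 2 := by nlinarith
  have hle : ⟪w, u + v⟫_ℝ ^ 2 ≤ ‖w‖ ^ 2 * ‖u + v‖ ^ 2 := by
    have := (abs_le.1 hcs)
    nlinarith [norm_nonneg w, norm_nonneg (u + v), abs_nonneg ⟪w, u + v⟫_ℝ, sq_abs ⟪w, u + v⟫_ℝ]
  nlinarith [norm_nonneg w, sq_nonneg ‖w‖]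

/-! ### The per-ball area bound -/

/-- For a ball `i` of a coplanar unit packing (`⊥ ν`): the volume of its lateral Voronoi cell slab plus
the volumes of the contact segments of its contact neighbours is at most the volume of its disc slab. -/
theorem volume_voronoi_add_sum_le (ν : EuclideanSpace ℝ (Fin 3)) (hν : ‖ν‖ = 1) {N : ℕ}
    (x : Fin N → EuclideanSpace ℝ (Fin 3)) (hx : IsUnitPacking x) (hcop : ∀ i j, ⟪x i - x j, ν⟫_ℝ = 0)
    (i : Fin N) :
    volume {y : EuclideanSpace ℝ (Fin 3) | lateralSq ν (x i) y ≤ blanketRadius ^ 2 ∧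
        |⟪y, ν⟫_ℝ| ≤ 1 / 2 ∧ ∀ j, lateralSq ν (x i) y ≤ lateralSq ν (x j) y} +
      ∑ j ∈ contactNeighbors x i, volume {y : EuclideanSpace ℝ (Fin 3) |
        lateralSq ν (x i) y ≤ 1 / 3 ∧ |⟪y, ν⟫_ℝ| ≤ 1 / 2 ∧ 1 / 2 < ⟪y - x i, x j - x i⟫_ℝ} ≤
      volume {y : EuclideanSpace ℝ (Fin 3) | lateralSq ν (x i) y ≤ blanketRadius ^ 2 ∧
        |⟪y, ν⟫_ℝ| ≤ 1 / 2} := by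
  have hr2 : blanketRadius ^ 2 = 1 / 3 := inv_sqrt_three_sq
  set V := {y : EuclideanSpace ℝ (Fin 3) | lateralSq ν (x i) y ≤ blanketRadius ^ 2 ∧
        |⟪y, ν⟫_ℝ| ≤ 1 / 2 ∧ ∀ j, lateralSq ν (x i) y ≤ lateralSq ν (x j) y} with hVdef
  set H : Fin N → Set (EuclideanSpace ℝ (Fin 3)) := fun j => {y |
        lateralSq ν (x i) y ≤ 1 / 3 ∧ |⟪y, ν⟫_ℝ| ≤ 1 / 2 ∧ 1 / 2 < ⟪y - x i, x j - x i⟫_ℝ} with hHdef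
  set D := {y : EuclideanSpace ℝ (Fin 3) | lateralSq ν (x i) y ≤ blanketRadius ^ 2 ∧
        |⟪y, ν⟫_ℝ| ≤ 1 / 2} with hDdef
  -- measurability
  have hHmeas : ∀ j, MeasurableSet (H j) := by
    intro j
    have h3 : Measurable fun y : EuclideanSpace ℝ (Fin 3) => ⟪y - x i, x j - x i⟫_ℝ := by
      have : Continuous fun y : EuclideanSpace ℝ (Fin 3) => ⟪y - x i, x j - x i⟫_ℝ := by fun_prop
      exact this.measurable
    exact (measurableSet_le (measurable_lateralSq ν (x i)) measurable_const).inter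
      ((measurableSet_le (measurable_abs_inner ν) measurable_const).inter
        (measurableSet_lt measurable_const h3))
  have hall : MeasurableSet {y : EuclideanSpace ℝ (Fin 3) | ∀ j, lateralSq ν (x i) y ≤ lateralSq ν (x j) y} := by
    have : {y : EuclideanSpace ℝ (Fin 3) | ∀ j, lateralSq ν (x i) y ≤ lateralSq ν (x j) y} =
        ⋂ j, {y | lateralSq ν (x i) y ≤ lateralSq ν (x j) y} := by ext y; simp
    rw [this]
    exact MeasurableSet.iInter fun j =>
      measurableSet_le (measurable_lateralSq ν (x i)) (measurable_lateralSq ν (x j))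
  have hVmeas : MeasurableSet V :=
    (measurableSet_le (measurable_lateralSq ν (x i)) measurable_const).inter
      ((measurableSet_le (measurable_abs_inner ν) measurable_const).inter hall)
  -- unit contact directions, orthogonal to ν, pairwise ≥ 60° apart
  have hunit : ∀ j ∈ contactNeighbors x i, ‖x j - x i‖ = 1 := by
    intro j hj
    rw [← dist_eq_norm, dist_comm]; exact ((mem_contactNeighbors x).1 hj).2
  have horth : ∀ j, ⟪x j - x i, ν⟫_ℝ = 0 := fun j => hcop j i
  have hsep : ∀ j ∈ contactNeighbors x i, ∀ k ∈ contactNeighbors x i, j ≠ k →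
      ⟪x j - x i, x k - x i⟫_ℝ ≤ 1 / 2 := by
    intro j hj k hk hjk
    have h1 := hx.one_le_dist hjk
    rw [dist_eq_norm] at h1
    have e : x j - x k = (x j - x i) - (x k - x i) := by abel
    have h2 : 1 ≤ ‖(x j - x i) - (x k - x i)‖ ^ 2 := by
      rw [← e]; nlinarith
    rw [norm_sub_sq_real, hunit j hj, hunit k hk] at h2
    linarith
  -- the segments are pairwise disjoint
  have hdisj : PairwiseDisjoint (↑(contactNeighbors x i) : Set (Fin N)) H := by
    intro j hj k hk hjk
    rw [Function.onFun, Set.disjoint_left]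
    intro y hyj hyk
    exact not_both_segments ν (x i) y (x j - x i) (x k - x i) hν (hunit j hj) (hunit k hk)
      (horth j) (horth k) (hsep j hj k hk hjk) hyj.1 hyj.2.2 hyk.2.2
  -- the Voronoi cell misses every segment
  have hVH : Disjoint V (⋃ j ∈ contactNeighbors x i, H j) := by
    rw [Set.disjoint_left]
    intro y hyV hyU
    simp only [Set.mem_iUnion] at hyU
    obtain ⟨j, hj, hyH⟩ := hyU
    have hd : dist (x i) (x j) = 1 := ((mem_contactNeighbors x).1 hj).2
    have := inner_le_half_of_voronoi ν (x i) (x j) y (hcop i j) hd (hyV.2.2 j)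
    exact absurd hyH.2.2 (not_lt.2 this)
  -- everything lies in the disc slab
  have hsub : V ∪ (⋃ j ∈ contactNeighbors x i, H j) ⊆ D := by
    rintro y (hy | hy)
    · exact ⟨hy.1, hy.2.1⟩
    · simp only [Set.mem_iUnion] at hy
      obtain ⟨j, -, hyH⟩ := hy
      exact ⟨by rw [hr2]; exact hyH.1, hyH.2.1⟩
  have hUmeas : MeasurableSet (⋃ j ∈ contactNeighbors x i, H j) :=
    MeasurableSet.biUnion (to_countable _) fun j _ => hHmeas j
  calc volume V + ∑ j ∈ contactNeighbors x i, volume (H j)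
      = volume V + volume (⋃ j ∈ contactNeighbors x i, H j) := by
        rw [measure_biUnion_finset hdisj fun j _ => hHmeas j]
    _ = volume (V ∪ ⋃ j ∈ contactNeighbors x i, H j) := (measure_union hVH hUmeas).symm
    _ ≤ volume D := measure_mono hsub

/-- **Per-ball bound**: in a coplanar unit packing the lateral Voronoi cell slab of ball `i` has volume
at most `π/3 − degᵢ · (π/18 − 1/(4√3))`. -/
theorem volume_voronoi_toReal_le (ν : EuclideanSpace ℝ (Fin 3)) (hν : ‖ν‖ = 1) {N : ℕ}
    (x : Fin N → EuclideanSpace ℝ (Fin 3)) (hx : IsUnitPacking x) (hcop : ∀ i j, ⟪x i - x j, ν⟫_ℝ = 0)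
    (i : Fin N) :
    (volume {y : EuclideanSpace ℝ (Fin 3) | lateralSq ν (x i) y ≤ blanketRadius ^ 2 ∧
        |⟪y, ν⟫_ℝ| ≤ 1 / 2 ∧ ∀ j, lateralSq ν (x i) y ≤ lateralSq ν (x j) y}).toReal ≤
      Real.pi / 3 - (coordination x i : ℝ) * (Real.pi / 18 - 1 / (4 * Real.sqrt 3)) := by
  have h := volume_voronoi_add_sum_le ν hν x hx hcop i
  have hunit : ∀ j ∈ contactNeighbors x i, ‖x j - x i‖ = 1 := by
    intro j hj
    rw [← dist_eq_norm, dist_comm]; exact ((mem_contactNeighbors x).1 hj).2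
  have hseg : ∀ j ∈ contactNeighbors x i, volume {y : EuclideanSpace ℝ (Fin 3) |
      lateralSq ν (x i) y ≤ 1 / 3 ∧ |⟪y, ν⟫_ℝ| ≤ 1 / 2 ∧ 1 / 2 < ⟪y - x i, x j - x i⟫_ℝ} =
      ENNReal.ofReal (Real.pi / 18 - 1 / (4 * Real.sqrt 3)) :=
    fun j hj => volume_segmentSlab ν (x j - x i) (x i) hν (hunit j hj) (hcop j i)
  rw [sum_congr rfl hseg, sum_const, nsmul_eq_mul] at h
  have hD : volume {y : EuclideanSpace ℝ (Fin 3) | lateralSq ν (x i) y ≤ blanketRadius ^ 2 ∧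
      |⟪y, ν⟫_ℝ| ≤ 1 / 2} = ENNReal.ofReal blanketRadius ^ 2 * ENNReal.ofReal Real.pi :=
    volume_lateralSlab ν hν (x i) blanketRadius blanketRadius_nonneg
  rw [hD] at h
  have hfinD : ENNReal.ofReal blanketRadius ^ 2 * ENNReal.ofReal Real.pi ≠ ⊤ :=
    ENNReal.mul_ne_top (ENNReal.pow_ne_top ENNReal.ofReal_ne_top) ENNReal.ofReal_ne_top
  have h' := ENNReal.toReal_mono hfinD h
  rw [ENNReal.toReal_add (ne_top_of_le_ne_top hfinD (le_trans le_self_add h))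
      (ne_top_of_le_ne_top hfinD (le_trans le_add_self h)),
    ENNReal.toReal_mul, ENNReal.toReal_natCast, ENNReal.toReal_ofReal segment_const_pos.le,
    ENNReal.toReal_mul, ENNReal.toReal_pow, ENNReal.toReal_ofReal blanketRadius_nonneg,
    ENNReal.toReal_ofReal Real.pi_pos.le] at h'
  have hr2 : blanketRadius ^ 2 = 1 / 3 := inv_sqrt_three_sq
  rw [hr2] at h' ⊢
  unfold coordination
  linarith

/-! ### Coplanar coordination is at most six -/

/-- In a unit packing whose centres lie in a plane `⊥ ν`, every ball has at most six contacts. -/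
theorem coordination_le_six_of_coplanar (ν : EuclideanSpace ℝ (Fin 3)) (hν : ‖ν‖ = 1) {N : ℕ}
    (x : Fin N → EuclideanSpace ℝ (Fin 3)) (hx : IsUnitPacking x) (hcop : ∀ i j, ⟪x i - x j, ν⟫_ℝ = 0)
    (i : Fin N) : coordination x i ≤ 6 := by
  obtain ⟨g, hg⟩ := exists_linearIsometryEquiv_apply_eq_single_two ν hν
  set F : Finset (EuclideanSpace ℝ (Fin 3)) := (contactNeighbors x i).image fun j => g (x j - x i)
    with hF
  have hinj : Set.InjOn (fun j => g (x j - x i)) ↑(contactNeighbors x i) := by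
    intro j _ k _ hjk
    have : x j - x i = x k - x i := g.injective hjk
    exact hx.injective (sub_left_injective this)
  have hcard : F.card = coordination x i := by
    rw [hF, card_image_of_injOn hinj]; rfl
  have hunit : ∀ j ∈ contactNeighbors x i, ‖x j - x i‖ = 1 := by
    intro j hj
    rw [← dist_eq_norm, dist_comm]; exact ((mem_contactNeighbors x).1 hj).2
  have hn : ∀ u ∈ F, ‖u‖ = 1 := by
    intro u hu
    obtain ⟨j, hj, rfl⟩ := mem_image.1 hu
    rw [g.norm_map, hunit j hj]
  have hz : ∀ u ∈ F, |u 2| ≤ 1 / 5 := by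
    intro u hu
    obtain ⟨j, hj, rfl⟩ := mem_image.1 hu
    have : (g (x j - x i)) 2 = ⟪x j - x i, ν⟫_ℝ := by
      rw [← g.inner_map_map (x j - x i) ν, hg]; simp [EuclideanSpace.inner_single_right]
    rw [this, hcop j i]; norm_num
  have hsep : ∀ u ∈ F, ∀ w ∈ F, u ≠ w → ⟪u, w⟫_ℝ ≤ 1 / 2 := by
    intro u hu w hw huw
    obtain ⟨j, hj, rfl⟩ := mem_image.1 hu
    obtain ⟨k, hk, rfl⟩ := mem_image.1 hw
    have hjk : j ≠ k := fun e => huw (by rw [e])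
    rw [g.inner_map_map]
    have h1 := hx.one_le_dist hjk
    rw [dist_eq_norm] at h1
    have e : x j - x k = (x j - x i) - (x k - x i) := by abel
    have h2 : 1 ≤ ‖(x j - x i) - (x k - x i)‖ ^ 2 := by rw [← e]; nlinarith
    rw [norm_sub_sq_real, hunit j hj, hunit k hk] at h2
    linarith
  rw [← hcard]
  exact card_thin_band_le_six hn hz hsep

/-! ### The coplanar blanket bound, by name -/

/-- The per-degree calibration: `2√3 (π/3 − d (π/18 − 1/(4√3))) ≤ 6 − d/2` for `d ≤ 6`
(equality iff `d = 6`: the hexagonal cell). -/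
theorem blanket_perBall_ineq (d : ℝ) (hd : d ≤ 6) :
    2 * Real.sqrt 3 * (Real.pi / 3 - d * (Real.pi / 18 - 1 / (4 * Real.sqrt 3))) ≤ 6 - d / 2 := by
  have h3 : 0 < Real.sqrt 3 := Real.sqrt_pos.2 (by norm_num)
  have h33 : Real.sqrt 3 * Real.sqrt 3 = 3 := Real.mul_self_sqrt (by norm_num)
  have hs3 : Real.sqrt 3 < 2 := by
    rw [Real.sqrt_lt' (by norm_num)]; norm_num
  have hπ : Real.pi < 4 := Real.pi_lt_four
  have key : 6 - d / 2 - 2 * Real.sqrt 3 * (Real.pi / 3 - d * (Real.pi / 18 - 1 / (4 * Real.sqrt 3))) =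
      (6 - d) * (1 - Real.sqrt 3 * Real.pi / 9) := by
    field_simp
    nlinarith [h33]
  have hpos : 0 ≤ (6 - d) * (1 - Real.sqrt 3 * Real.pi / 9) := by
    apply mul_nonneg (by linarith)
    nlinarith [Real.pi_pos]
  linarith

/-- **`BlanketBoundCoplanar`** (planner cf-p1 g14's rung of the BLANKET line, `lines/blanket/Blanket.lean`,
BY NAME; `shadowArea`, `blanketRadius` as landed in `…CellFluxDefs`).  For every finite unit packing whose
centres lie in one plane orthogonal to the unit vector `ν`:
`2√3 · S_ν(x; 1/√3) ≤ 6 N − C(x)`.  Tight for large patches of the hexagonal layer. -/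
theorem blanketBoundCoplanar : ∀ (N : ℕ) (x : Fin N → EuclideanSpace ℝ (Fin 3)),
    Summit.Ventures.Crystal3D.IsUnitPacking x → ∀ ν : EuclideanSpace ℝ (Fin 3), ‖ν‖ = 1 →
      (∀ i j, ⟪x i - x j, ν⟫_ℝ = 0) →
        2 * Real.sqrt 3 *
            Summit.Ventures.Crystal3D.Cruxes.NoReconstructionGain.CellFlux.shadowArea ν
              Summit.Ventures.Crystal3D.Cruxes.NoReconstructionGain.CellFlux.blanketRadius x ≤
          6 * (N : ℝ) - (Summit.Ventures.Crystal3D.numContacts x : ℝ) := by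
  intro N x hx ν hν hcop
  -- the Voronoi cells
  set V : Fin N → Set (EuclideanSpace ℝ (Fin 3)) := fun i => {y | lateralSq ν (x i) y ≤ blanketRadius ^ 2 ∧
      |⟪y, ν⟫_ℝ| ≤ 1 / 2 ∧ ∀ j, lateralSq ν (x i) y ≤ lateralSq ν (x j) y} with hVdef
  have hfinV : ∀ i, volume (V i) ≠ ⊤ := by
    intro i
    have hsub : V i ⊆ {y : EuclideanSpace ℝ (Fin 3) | lateralSq ν (x i) y ≤ blanketRadius ^ 2 ∧
        |⟪y, ν⟫_ℝ| ≤ 1 / 2} := fun y hy => ⟨hy.1, hy.2.1⟩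
    refine ne_top_of_le_ne_top ?_ (measure_mono hsub)
    rw [volume_lateralSlab ν hν (x i) blanketRadius blanketRadius_nonneg]
    exact ENNReal.mul_ne_top (ENNReal.pow_ne_top ENNReal.ofReal_ne_top) ENNReal.ofReal_ne_top
  -- the shadow is covered by the cells
  have hcover : volume (shadowSlab ν blanketRadius x) ≤ ∑ i, volume (V i) :=
    (measure_mono (shadowSlab_subset_iUnion_voronoi ν blanketRadius x)).trans
      (measure_iUnion_fintype_le _ _)
  have hsumfin : ∑ i, volume (V i) ≠ ⊤ := ENNReal.sum_ne_top.2 fun i _ => hfinV i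
  have hS : shadowArea ν blanketRadius x ≤ ∑ i, (volume (V i)).toReal := by
    unfold shadowArea
    rw [← ENNReal.toReal_sum fun i _ => hfinV i]
    exact ENNReal.toReal_mono hsumfin hcover
  -- per-ball bounds
  have hball : ∀ i, (volume (V i)).toReal ≤
      Real.pi / 3 - (coordination x i : ℝ) * (Real.pi / 18 - 1 / (4 * Real.sqrt 3)) :=
    fun i => volume_voronoi_toReal_le ν hν x hx hcop i
  have hdeg : ∀ i, (coordination x i : ℝ) ≤ 6 := fun i => by
    exact_mod_cast coordination_le_six_of_coplanar ν hν x hx hcop i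
  have hper : ∀ i, 2 * Real.sqrt 3 * (volume (V i)).toReal ≤ 6 - (coordination x i : ℝ) / 2 := by
    intro i
    have h1 := mul_le_mul_of_nonneg_left (hball i) (by positivity : (0 : ℝ) ≤ 2 * Real.sqrt 3)
    exact h1.trans (blanket_perBall_ineq _ (hdeg i))
  have hsum : ∑ i, 2 * Real.sqrt 3 * (volume (V i)).toReal ≤ ∑ i, (6 - (coordination x i : ℝ) / 2) :=
    sum_le_sum fun i _ => hper i
  rw [← mul_sum, sum_sub_distrib, sum_const, card_univ, Fintype.card_fin, nsmul_eq_mul,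
    ← sum_div] at hsum
  have hhand : ∑ i, (coordination x i : ℝ) = 2 * (numContacts x : ℝ) := by
    exact_mod_cast sum_coordination_eq x
  rw [hhand] at hsum
  have h3 : 0 ≤ Real.sqrt 3 := Real.sqrt_nonneg 3
  nlinarith [mul_le_mul_of_nonneg_left hS (by positivity : (0 : ℝ) ≤ 2 * Real.sqrt 3)]

end Summit.Ventures.Crystal3D.Theorems

end
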